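import Summits.NavierStokesRegularity.NavierStokesRegularity.Theorems.QuantisedSymmetryPolyhedralDssProfileExistsOfCell
import Summits.NavierStokesRegularity.NavierStokesRegularity.Theorems.QuantisedSymmetryPolyhedralDssProfileExistsDominatesBlowupProfile
import Literature.Analysis.FluidPDE.ForcedHeatDuhamelHolder
import HarnessLib

/-!
# Strategy census s14-g4 — typed signatures (crux `QuantisedSymmetry.PolyhedralDssProfileExists`,
# stmt-NavierStokesRegularity-1404). Planner sketch: statements + trivial logic only, no sorry.

§1 weaker intermediates (sector-free profile ⇔ ¬Tsai-DSS-Liouville for some λ ⇒ 0155);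
§2 the best typed split (approximate-cell compactness E1 ∧ non-degenerate approximate family E2) with
   its proved assembly, and the collapse claim recorded as a Prop;
§3 the negation as a special case of Tsai's conjecture.
-/

set_option linter.dupNamespace false
set_option autoImplicit false

noncomputable section

namespace Summit.NavierStokesRegularity.NavierStokesRegularity.Cruxes.PolyhedralDssProfileExists.CensusS14g4

open MeasureTheory Set
open Literature.Analysis.FluidPDE

local notation "E3" => EuclideanSpace ℝ (Fin 3)

/-- The crux, by name. -/
abbrev X : Prop :=
  Summit.NavierStokesRegularity.NavierStokesRegularity.Theses.QuantisedSymmetry.PolyhedralDssProfileExists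

/-- The group clauses of the crux: finite, rotations, irreducible. -/
def IsPolyhedralGroup (G : Subgroup (E3 ≃ₗᵢ[ℝ] E3)) : Prop :=
  Finite G ∧
  (∀ g ∈ G, LinearMap.det (g.toLinearEquiv : E3 →ₗ[ℝ] E3) = 1) ∧
  (∀ V : Submodule ℝ E3, (∀ g ∈ G, ∀ v ∈ V, g v ∈ V) → V = ⊥ ∨ V = ⊤)

/-! ## §1 Weaker intermediates -/

/-- W₁: a nontrivial Type-I `λ`-DSS ancient mild profile, NO symmetry clause. -/
def SectorFreeProfileExists : Prop :=
  ∃ c : ℝ, 1 < c ∧ ∃ u : ℝ → E3 → E3,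
    IsAncientMildSolution 1 u ∧ (∀ t < 0, AEStronglyMeasurable (u t) volume) ∧
    IsDiscretelySelfSimilar c u ∧ (∃ C₀ : ℝ, HasTypeIDecay C₀ u) ∧ ¬ (∀ t < 0, u t =ᵐ[volume] 0)

/-- X ⇒ W₁: the group clauses are simply discarded. -/
theorem sectorFree_of_crux : X → SectorFreeProfileExists := by
  rintro ⟨G, -, -, -, c, hc, u, h1, h2, h3, h4, -, h6⟩
  exact ⟨c, hc, u, h1, h2, h3, h4, h6⟩

/-- W₁ is literally "Tsai's Type-I DSS Liouville statement fails for some factor". -/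
theorem sectorFree_iff_exists_not_liouville :
    SectorFreeProfileExists ↔ ∃ c : ℝ, ¬ TypeIDSSLiouville c := by
  constructor
  · rintro ⟨c, hc, u, h1, h2, h3, h4, h6⟩
    exact ⟨c, fun hL => h6 (hL hc u h1 h2 h3 h4)⟩
  · rintro ⟨c, hc⟩
    by_contra hne
    apply hc
    intro hc1 u h1 h2 h3 h4
    by_contra hz
    exact hne ⟨c, hc1, u, h1, h2, h3, h4, hz⟩

/-- W₁ ⇒ 0155 (`Blowup.BlowupTypeIDssProfile`, the sector-agnostic crux already in the tree). -/
theorem blowupProfile_of_sectorFree :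
    SectorFreeProfileExists →
      Summit.NavierStokesRegularity.NavierStokesRegularity.Theses.Blowup.BlowupTypeIDssProfile := by
  intro h hall
  obtain ⟨c, hc⟩ := sectorFree_iff_exists_not_liouville.mp h
  exact hc (hall c).1

/-- The chain X ⇒ W₁ ⇒ 0155 (cf. the registered `stub_dominatesBlowupProfile`). -/
theorem blowupProfile_of_crux :
    X → Summit.NavierStokesRegularity.NavierStokesRegularity.Theses.Blowup.BlowupTypeIDssProfile :=
  fun h => blowupProfile_of_sectorFree (sectorFree_of_crux h)

/-! ## §2 The best typed split: approximate cells (E2) + compactness (E1) -/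

/-- An EXACT `G`-cell on the model period `[-1, -c⁻²]` — verbatim the hypothesis block of the
registered reduction `stub_profileOfPolyhedralCell`. -/
def IsExactCell (G : Subgroup (E3 ≃ₗᵢ[ℝ] E3)) (c : ℝ) (v : ℝ → E3 → E3) : Prop :=
  ContinuousOn (Function.uncurry v) (Set.Icc (-1 : ℝ) (-(c ^ 2)⁻¹) ×ˢ Set.univ) ∧
  (∃ M : ℝ, ∀ t ∈ Set.Icc (-1 : ℝ) (-(c ^ 2)⁻¹), ∀ x, ‖v t x‖ ≤ M) ∧
  (∀ t ∈ Set.Icc (-1 : ℝ) (-(c ^ 2)⁻¹), IsWeaklyDivFree (v t)) ∧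
  (∀ s t : ℝ, -1 ≤ s → s < t → t ≤ -(c ^ 2)⁻¹ → ∀ x,
    v t x = heatFlow (v s) (t - s) x - oseenDuhamel 1 s v v t x) ∧
  (∀ x, v (-(c ^ 2)⁻¹) x = c • v (-1) (c • x)) ∧
  (∀ g ∈ G, ∀ t ∈ Set.Icc (-1 : ℝ) (-(c ^ 2)⁻¹), ∀ x, v t (g x) = g (v t x))

/-- An APPROXIMATE `G`-cell with Type-I constant `C₀` and forcing defect `ε`: the forced Oseen-mild
identity `v(t) = e^{(t-s)Δ}v(s) − B_s(v,v)(t) + ∫_s^t e^{(t-τ)Δ} f(τ) dτ` with a forcing `f` that is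
`ε`-small in the Type-I weight of a force (`(‖x‖+√(-t))³‖f‖ ≤ ε`), EXACT zoom closing, exact
`G`-equivariance, and the uniform Type-I bound `‖v(t,x)‖ ≤ C₀/(‖x‖+√(-t))`. (Galerkin rays, Newton
iterates and truncations of a putative orbit are all of this shape.) -/
def IsApproxCell (G : Subgroup (E3 ≃ₗᵢ[ℝ] E3)) (c C₀ ε : ℝ) (v f : ℝ → E3 → E3) : Prop :=
  ContinuousOn (Function.uncurry v) (Set.Icc (-1 : ℝ) (-(c ^ 2)⁻¹) ×ˢ Set.univ) ∧
  (∀ t ∈ Set.Icc (-1 : ℝ) (-(c ^ 2)⁻¹), IsWeaklyDivFree (v t)) ∧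
  (∀ s t : ℝ, -1 ≤ s → s < t → t ≤ -(c ^ 2)⁻¹ → ∀ x,
    v t x = heatFlow (v s) (t - s) x - oseenDuhamel 1 s v v t x + heatDuhamel s f t x) ∧
  (∀ x, v (-(c ^ 2)⁻¹) x = c • v (-1) (c • x)) ∧
  (∀ g ∈ G, ∀ t ∈ Set.Icc (-1 : ℝ) (-(c ^ 2)⁻¹), ∀ x, v t (g x) = g (v t x)) ∧
  (∀ t ∈ Set.Icc (-1 : ℝ) (-(c ^ 2)⁻¹), ∀ x : E3, ‖v t x‖ ≤ C₀ / (‖x‖ + Real.sqrt (-t))) ∧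
  (∀ t ∈ Set.Icc (-1 : ℝ) (-(c ^ 2)⁻¹), ∀ x : E3, (‖x‖ + Real.sqrt (-t)) ^ 3 * ‖f t x‖ ≤ ε)

/-- **E2 (the hard piece).** In some polyhedral sector, for some factor and Type-I constant, there are
approximate cells of arbitrarily small defect whose data keep a fixed amount `δ` of `L²` mass in a
fixed ball (non-degeneracy floor). -/
def NondegenerateApproxFamily : Prop :=
  ∃ G : Subgroup (E3 ≃ₗᵢ[ℝ] E3), IsPolyhedralGroup G ∧ ∃ c : ℝ, 1 < c ∧ ∃ C₀ δ R : ℝ, 0 < δ ∧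
    ∀ ε > 0, ∃ v f : ℝ → E3 → E3, IsApproxCell G c C₀ ε v f ∧
      δ ≤ ∫ x in Metric.ball (0 : E3) R, ‖v (-1) x‖ ^ 2

/-- **E1 (compactness; provable — Aubin–Lions on the slab, uniform Type-I bound ⇒ local parabolic
regularity ⇒ locally uniform convergence of a subsequence; the zoom, equivariance, mild identity and
the mass floor pass to the limit; `L⁴` datum from the Type-I bound).** -/
def ApproxCompactness : Prop :=
  ∀ G : Subgroup (E3 ≃ₗᵢ[ℝ] E3), IsPolyhedralGroup G → ∀ c : ℝ, 1 < c → ∀ C₀ δ R : ℝ, 0 < δ →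
    (∀ ε > 0, ∃ v f : ℝ → E3 → E3, IsApproxCell G c C₀ ε v f ∧
      δ ≤ ∫ x in Metric.ball (0 : E3) R, ‖v (-1) x‖ ^ 2) →
    ∃ v : ℝ → E3 → E3, IsExactCell G c v ∧ MemLp (v (-1)) 4 volume ∧ ¬ (v (-1) =ᵐ[volume] 0)

/-- **Assembly of the split, proved:** E1 → E2 → X (through the registered cell reduction). -/
theorem crux_of_split : ApproxCompactness → NondegenerateApproxFamily → X := by
  intro hE1 hE2
  obtain ⟨G, hG, c, hc, C₀, δ, R, hδ, hfam⟩ := hE2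
  obtain ⟨v, hcell, hL4, hnt⟩ := hE1 G hG c hc C₀ δ R hδ hfam
  exact Summit.NavierStokesRegularity.NavierStokesRegularity.Theorems.PolyhedralDssProfileExists.PolyhedralCell.stub_profileOfPolyhedralCell
    ⟨G, hG.1, hG.2.1, hG.2.2, c, hc, v, hcell, hL4, hnt⟩

/-- **Collapse claim (why E2 is the crux again, up to a provable lemma):** an exact witness is its own
approximating family with `f = 0` (the cell of the profile, `stub_cellOfProfile`, has continuous
nontrivial datum, hence positive `L²` mass on some ball, and the Type-I bound of the profile).
Recorded as a `Prop`; its proof is routine (`heatDuhamel s 0 = 0`, `polyhedralDssProfileExists_iff_cell`). -/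
def CollapseClaim : Prop := X → NondegenerateApproxFamily

/-! ## §3 Negation: the polyhedral Type-I DSS Liouville statement -/

/-- ¬X, positively phrased: Liouville for Type-I `λ`-DSS ancient mild profiles in every polyhedral sector. -/
def PolyhedralTypeIDssLiouville : Prop :=
  ∀ G : Subgroup (E3 ≃ₗᵢ[ℝ] E3), IsPolyhedralGroup G → ∀ c : ℝ, 1 < c → ∀ u : ℝ → E3 → E3,
    IsAncientMildSolution 1 u → (∀ t < 0, AEStronglyMeasurable (u t) volume) →
    IsDiscretelySelfSimilar c u → (∃ C₀ : ℝ, HasTypeIDecay C₀ u) →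
    (∀ g ∈ G, ∀ t x, u t (g x) = g (u t x)) → ∀ t < 0, u t =ᵐ[volume] 0

theorem not_crux_iff : ¬ X ↔ PolyhedralTypeIDssLiouville := by
  constructor
  · intro h G hG c hc u h1 h2 h3 h4 h5
    by_contra hz
    exact h ⟨G, hG.1, hG.2.1, hG.2.2, c, hc, u, h1, h2, h3, h4, h5, hz⟩
  · rintro h ⟨G, hf, hd, hi, c, hc, u, h1, h2, h3, h4, h5, hz⟩
    exact hz (h G ⟨hf, hd, hi⟩ c hc u h1 h2 h3 h4 h5)

/-- The negation is a SPECIAL CASE of Tsai's conjecture (Bradshaw–Tsai OP 5.1): -/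
theorem polyhedralLiouville_of_tsai : (∀ c : ℝ, TypeIDSSLiouville c) → PolyhedralTypeIDssLiouville := by
  intro hT G _ c hc u h1 h2 h3 h4 _
  exact hT c hc u h1 h2 h3 h4

/-- … and so ¬X is implied by, not equivalent to, the sector-free Liouville statement. -/
theorem not_crux_of_not_sectorFree : ¬ SectorFreeProfileExists → ¬ X :=
  fun h hx => h (sectorFree_of_crux hx)

end Summit.NavierStokesRegularity.NavierStokesRegularity.Cruxes.PolyhedralDssProfileExists.CensusS14g4

end
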